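import Summits.SmoothPoincare4.SmoothPoincare4.Theses.SblfDescent
import Summits.SmoothPoincare4.SmoothPoincare4.Theorems.SblfDescentRungOne
import Literature.Topology.FourManifolds.SimplifiedBrokenLefschetzEulerCount
import Literature.Topology.FourManifolds.SimplifiedBrokenLefschetzSidesGenus
import Literature.Topology.FourManifolds.SimplifiedBrokenLefschetzRoundSlicesIndex
import Literature.Topology.FourManifolds.MorseTwoCriticalPoints
import Literature.Topology.FourManifolds.AkbulutKirbyCerfReduction
import Literature.Topology.FourManifolds.ClosedBall
import Literature.Topology.FourManifolds.TorusDiffeoLoops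
import Literature.Topology.FourManifolds.SphereFourGenusOneSplitting
import Literature.Topology.FourManifolds.SimplifiedBrokenLefschetzSphereSideTube
import Literature.Topology.FourManifolds.GluingIsotopyProofs
import Literature.Topology.FourManifolds.GluingProofs
import Literature.Topology.FourManifolds.SphereDiffeoLoops
import Literature.Topology.FourManifolds.SmaleDiffDisc
import Summits.SmoothPoincare4.SmoothPoincare4.Theorems.SblfDescentRungOneStubAngularSubmersion
import Summits.SmoothPoincare4.SmoothPoincare4.Theorems.SblfDescentRungOneStubRoundCriticalPoints
import Summits.SmoothPoincare4.SmoothPoincare4.Theorems.SblfDescentRungOneStubBaseFunction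
import Summits.SmoothPoincare4.SmoothPoincare4.Theorems.SblfDescentRungOneStubSixCrit
import Summits.SmoothPoincare4.SmoothPoincare4.Theorems.SblfDescentRungOneStubSliceRecognition
import Summits.SmoothPoincare4.SmoothPoincare4.Theorems.SblfDescentRungOneHelperCircleSubmersion
import Literature.Topology.FourManifolds.SmoothSchoenfliesFiveLeCap
import Literature.Topology.FourManifolds.Morse
import Summits.SmoothPoincare4.SmoothPoincare4.Theorems.SblfDescentRungOneDefs
import HarnessLib

/-!
# Line `Sketch` — skeleton for crux `SblfDescent.RungOne` (item stmt-SmoothPoincare4-18531)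

Route `SblfDescent`, sub-problem `SmoothPoincare4`; idea cards
`Cruxes/RungOne/Ideas/one-morse-function-forced-cancellations.md` (endgame (a)) and
`Cruxes/RungOne/Ideas/clutch-in-dimension-two.md` (its first lemma, the angular submersion);
lead `prover-line-stmt-SmoothPoincare4-18531-0`, 2026-08-17.

Crux (fixed, never restated): a smooth `M ≃ₕ S⁴` carrying the route's `HAS(M, 0)` (a simplified
broken Lefschetz fibration of genus one with non-empty round locus) is diffeomorphic to `S⁴`.

## State of the tree used here

`RungOne ⇐ A ∧ B` is kernel-checked in `Theorems/SblfDescentRungOne.lean`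
(`RungOne_of_eulerCount_of_noLefschetz`), the Euler count `A` is DISCHARGED
(`card_eq_four_mul_of_sblf_of_homotopyEquiv_sphere_four_holds`), so the crux is fact `B`
(`nonempty_diffeomorph_sphere_four_of_sblf_genus_one_noLefschetz`, Baykur–Kamada 2015, Lemma 11 +
Cor. 14): a closed simply connected `X` with a genus-one Lefschetz-free SBLF is `S⁴`.

## The line: one Morse function with six critical points, two Milnor cancellations, Cerf

Normalise the round image to the equator (`exists_image_round_eq_sphereEquator`), let `v` be the
pole of the torus side (`exists_pole_lower_higher_sides`) and take the base function
`ℓ(y) = y₀ (1 - ¼ ⟪y, v⟫)` on `S²`: it has exactly two critical points `m`, `M` (min, max), BOTH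
on the sphere side, and `ℓ|equator = y₀` has its extrema at `(∓1, 0, 0)`, where `ℓ` increases
into the torus side, resp. into the sphere side.  Hence `ℓ ∘ f`, perturbed fibrewise over `m` and
`M` by `ε μ` (`μ` a two-point Morse function on the sphere fibre, in the product structure `ι` of
the sphere side), is a Morse function `G` on `X` with exactly SIX critical points, of indices
`0, 2` (over `m`), `1` (round point over `(-1,0,0)`), `3` (round point over `(1,0,0)`), `2, 4`
(over `M`) — `stub_sixCrit`, fed by `stub_baseFunction` (the calculus of `ℓ` on `S²`) and
`stub_roundCriticalPoints` (the fold-chart Hessian at the two round points, after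
`round_point_height`).  The apex `stub_twoCrit` cancels the pairs `(2_m, 3)` and `(1, 2_M)` by
Milnor's Thms. 4.1/4.2 and 5.4 (PROVED in the tree: `Cobordism.Milnor1965_rearrangement_slab_holds`,
`Cobordism.Milnor1965_firstCancellation_slab_holds`), the two single-transverse-intersection
hypotheses being the SBLF-specific content (sweep of the vanishing cycles; `π₁ = 1` enters here),
using the angular submersion at the fold (`stub_angularSubmersion`) to fibre the round region over
the circle.  Two critical points make `X` a twisted sphere (PROVED:
`IsMorse.exists_isTwistedSphere_of_ncard_criticalSet_eq_two`) and Cerf's `Γ₄ = 0` (`stub_cerf` =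
the named fact `cerf_twistedSphere_four`, the line's only literature debt) gives `S⁴`.

Registered stubs (reshape 2, 2026-08-17T15:45Z): `stub_angularSubmersion` (S/M, landed p167379),
`stub_baseFunction` (M/L), `stub_roundCriticalPoints` (L, landed p167637), `stub_sixCrit` (L/XL)
— bricks of the Morse variant; `stub_torusLoops` (named fact Earle–Eells-lite, filed as
`TorusDiffeoLoops.lean`); `stub_sliceRecognition` (L, Cerf/LP-free model recognition);
`stub_sliceGluing` (apex, XL, lead).  Proved here: `RungOne_of`, the crux BY NAME, through the
main composition `noLefschetz_of_stubs` (Stubs 1, 5, 6, 7); the Morse endgame is kept as the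
conditional `noLefschetz_of_morseEndgame` (hypotheses: two cancellations, Cerf).
-/

set_option linter.dupNamespace false

noncomputable section

open scoped Manifold ContDiff Topology RealInnerProductSpace
open Set Function Literature.Topology.FourManifolds Literature.AlgebraicTopology.SingularHomology

namespace Summit.SmoothPoincare4.SmoothPoincare4.Cruxes.RungOne.Sketch

/-- Local notation: `𝔼 n` is the model Euclidean space `EuclideanSpace ℝ (Fin n)`. -/
local notation "𝔼 " n:arg => EuclideanSpace ℝ (Fin n)

/-- Local notation: `𝕊²`, the unit sphere of `ℝ³`. -/
local notation "𝕊²" => (Metric.sphere (0 : EuclideanSpace ℝ (Fin 3)) (1 : ℝ))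

attribute [local instance] Literature.Topology.FourManifolds.fact_finrank_euclideanSpace_succ

/-! ### Stub 1 — the angular submersion at the fold: LANDED

`stub_angularSubmersion` (first lemma of card `clutch-in-dimension-two`) is PROVED in
`Theorems/SblfDescentRungOneStubAngularSubmersion.lean` (p167379, imported above) and used below by
name. -/

/-! ### Stub 2 — the base function `ℓ(y) = y₀ (1 - ¼⟪y, v⟫)` on the `2`-sphere: LANDED

`stub_baseFunction` is PROVED in `Theorems/SblfDescentRungOneStubBaseFunction.lean` (p169030, accepted; imported above)
and is available below by name. -/

/-! ### Stub 3 — the two round critical points of `ℓ ∘ f`: LANDED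

`stub_roundCriticalPoints` is PROVED in `Theorems/SblfDescentRungOneStubRoundCriticalPoints.lean`
(p167637, accepted; imported above) and is available below by name. -/

/-! ### Stub 4 — the six-point Morse function: LANDED

`stub_sixCrit` is PROVED in `Theorems/SblfDescentRungOneStubSixCrit.lean` (p170071, accepted; imported above)
and is available below by name. -/

/-! ### Stub 5 — Earle–Eells-lite (named literature fact, external to this line) -/

/-- **Earle–Eells 1969 / Gramain 1973, the torus at `π₁`**: every smooth based loop of
diffeomorphisms of the torus deforms, through based loops with the same evaluation path, to the
loop of translations — the tree's named fact `gramain_loopHomotopy_translationLoop_torus`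
(`TorusDiffeoLoops.lean`, filed by this line).  It straightens the loop of vanishing cycles of the
round circle; the only literature debt of the line's main composition.
[cite: Gramain1973, Théorème 1 (p. 54) and §1 "Le tore" (p. 57)] [cite: EarleEells1969, main theorem (torus case)] -/
theorem stub_torusLoops : gramain_loopHomotopy_translationLoop_torus := by
  sorry

/-! ### Stub 6 — four-sphere recognition from a SLICE-PRESERVING genus-one gluing (Cerf- and LP-free): LANDED

`stub_sliceRecognition` is PROVED in `Theorems/SblfDescentRungOneStubSliceRecognition.lean` (p170063, accepted; imported above)
and is available below by name. -/

/-! ### Stub 7a-N (apex brick N) — the `S¹`-parametric fold normal form of the round circle -/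

/-- **Brick N: the `S¹`-parametric fold normal form.**  A neighbourhood of the round circle of a
genus-one Lefschetz-free SBLF with equatorial round image is `S¹ × B³_ε` with
`f(ν(u, x)) = (√(1 - Q²) u, v₂ Q)`, `Q = x₀² + x₁² - x₂²` (pages = longitude preimages by the
circle submersion; parametric Morse lemma on the normal slices along the circle; the round handle
is untwisted — a periodic timelike field exists — because a twisted one reverses the vanishing
cycle, which is essential in `H₁` of the torus fibre).
[cite: Hayano2011, Def. 2.1 (4)] [cite: BanyagaHurtubise2004, Thm. 2] [cite: HirschDT1976, Ch. 6 §1] -/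
theorem helper_sliceGluing_foldNormalForm :
    ∀ (X : Type) [TopologicalSpace X] [T2Space X] [SecondCountableTopology X] [CompactSpace X] [ChartedSpace (𝔼 4) X] [IsManifold (𝓡 4) ∞ X] (o : SmoothOrientation (𝓡 4) X) (f : X → 𝕊²), IsSimplifiedBrokenLefschetzFibration o f ∅ 0 → f '' ({p : X | ¬ Surjective (mfderiv (𝓡 4) (𝓡 2) f p)} \ (↑(∅ : Finset X) : Set X)) = sphereEquator 1 → ∀ (v : 𝕊²), (v : 𝔼 3) 0 = 0 → (v : 𝔼 3) 1 = 0 → (∀ y : 𝕊², ⟪(y : 𝔼 3), (v : 𝔼 3)⟫ < 0 → (∀ q, f q = y → Surjective (mfderiv (𝓡 4) (𝓡 2) f q)) ∧ Nonempty ((Fin (2 * 0) → ℤ) ≃ₗ[ℤ] singularHomology ℤ ℤ ↥(f ⁻¹' {y}) 1)) → (∀ y : 𝕊², ⟪(y : 𝔼 3), ((-v : 𝕊²) : 𝔼 3)⟫ < 0 → (∀ q, f q = y → Surjective (mfderiv (𝓡 4) (𝓡 2) f q)) ∧ Nonempty ((Fin (2 * (0 + 1)) → ℤ) ≃ₗ[ℤ]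 singularHomology ℤ ℤ ↥(f ⁻¹' {y}) 1)) → ∃ (ε : ℝ) (ν : (Metric.sphere (0 : 𝔼 2) 1) × 𝔼 3 → X), 0 < ε ∧ ε < 1 ∧ ContMDiffOn ((𝓡 1).prod 𝓘(ℝ, 𝔼 3)) (𝓡 4) ∞ ν (Set.univ ×ˢ Metric.ball 0 ε) ∧ Set.InjOn ν (Set.univ ×ˢ Metric.ball 0 ε) ∧ IsOpen (ν '' (Set.univ ×ˢ Metric.ball 0 ε)) ∧ (∀ p : (Metric.sphere (0 : 𝔼 2) 1) × 𝔼 3, p.2 ∈ Metric.ball (0 : 𝔼 3) ε → Function.Injective (mfderiv ((𝓡 1).prod 𝓘(ℝ, 𝔼 3)) (𝓡 4) ν p)) ∧ (∀ q : X, ¬ Surjective (mfderiv (𝓡 4) (𝓡 2) f q) ↔ ∃ u, ν (u, 0) = q) ∧ (∀ (u : Metric.sphere (0 : 𝔼 2) 1) (x : 𝔼 3), x ∈ Metric.ball (0 : 𝔼 3) ε → ((f (ν (u, x)) : 𝕊²) : 𝔼 3) 0 = √(1 - (x 0 ^ 2 + x 1 ^ 2 - x 2 ^ 2) ^ 2)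 * (u : 𝔼 2) 0 ∧ ((f (ν (u, x)) : 𝕊²) : 𝔼 3) 1 = √(1 - (x 0 ^ 2 + x 1 ^ 2 - x 2 ^ 2) ^ 2) * (u : 𝔼 2) 1 ∧ ((f (ν (u, x)) : 𝕊²) : 𝔼 3) 2 = (v : 𝔼 3) 2 * (x 0 ^ 2 + x 1 ^ 2 - x 2 ^ 2)) := by
  sorry

/-! ### Stub 7a-Ang-C (apex leaf F2-collar) — rigid torus coordinates on a collar band -/

/-- **Leaf: rigid torus coordinates on a collar band `{s₁ < ⟪f, v⟫ < s₂}`, matched to the fold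
tube** (`aC (ν (u, x)) = R(-g x₂)(u₀, σ u₁)` for any prescribed steep odd profile `g` with
`g' > 0`, `|g| < π/2`, and sign `σ`): flows with model behaviour on the tube, monodromy forced
trivial (winding) and straightened by the annulus twist lemma, one-fibre annulus coordinates from
the sphere side. [cite: BaykurKamada2015, §2] [cite: FarbMargalit2012, Prop. 2.4] -/
theorem helper_sliceGluing_rigidCollar :
    ∀ (X : Type) [TopologicalSpace X] [T2Space X] [SecondCountableTopology X] [CompactSpace X] [ChartedSpace (𝔼 4) X] [IsManifold (𝓡 4) ∞ X] (o : SmoothOrientation (𝓡 4) X) (f : X → 𝕊²), IsSimplifiedBrokenLefschetzFibration o f ∅ 0 → f '' ({p : X | ¬ Surjective (mfderiv (𝓡 4) (𝓡 2) f p)} \ (↑(∅ : Finset X) : Set X)) = sphereEquator 1 → ∀ (v : 𝕊²), (v : 𝔼 3) 0 = 0 → (v : 𝔼 3) 1 = 0 → (∀ y : 𝕊², ⟪(y : 𝔼 3), (v : 𝔼 3)⟫ < 0 → (∀ q, f q = y → Surjective (mfderiv (𝓡 4) (𝓡 2) f q)) ∧ Nonempty ((Fin (2 * 0) → ℤ)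 ≃ₗ[ℤ] singularHomology ℤ ℤ ↥(f ⁻¹' {y}) 1)) → (∀ y : 𝕊², ⟪(y : 𝔼 3), ((-v : 𝕊²) : 𝔼 3)⟫ < 0 → (∀ q, f q = y → Surjective (mfderiv (𝓡 4) (𝓡 2) f q)) ∧ Nonempty ((Fin (2 * (0 + 1)) → ℤ) ≃ₗ[ℤ] singularHomology ℤ ℤ ↥(f ⁻¹' {y}) 1)) → ∀ (ε : ℝ) (ν : (Metric.sphere (0 : 𝔼 2) 1) × 𝔼 3 → X), 0 < ε → ε < 1 → ContMDiffOn ((𝓡 1).prod 𝓘(ℝ, 𝔼 3)) (𝓡 4) ∞ ν (Set.univ ×ˢ Metric.ball 0 ε) → Set.InjOn ν (Set.univ ×ˢ Metric.ball 0 ε) → IsOpen (ν '' (Set.univ ×ˢ Metric.ball 0 ε)) → (∀ p : (Metric.sphere (0 : 𝔼 2) 1) × 𝔼 3, p.2 ∈ Metric.ball (0 : 𝔼 3) ε → Function.Injective (mfderiv ((𝓡 1).prod 𝓘(ℝ, 𝔼 3)) (𝓡 4) ν p)) → (∀ q : X, ¬ Surjective (mfderiv (𝓡 4) (𝓡 2)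 f q) ↔ ∃ u, ν (u, 0) = q) → (∀ (u : Metric.sphere (0 : 𝔼 2) 1) (x : 𝔼 3), x ∈ Metric.ball (0 : 𝔼 3) ε → ((f (ν (u, x)) : 𝕊²) : 𝔼 3) 0 = √(1 - (x 0 ^ 2 + x 1 ^ 2 - x 2 ^ 2) ^ 2) * (u : 𝔼 2) 0 ∧ ((f (ν (u, x)) : 𝕊²) : 𝔼 3) 1 = √(1 - (x 0 ^ 2 + x 1 ^ 2 - x 2 ^ 2) ^ 2) * (u : 𝔼 2) 1 ∧ ((f (ν (u, x)) : 𝕊²) : 𝔼 3) 2 = (v : 𝔼 3) 2 * (x 0 ^ 2 + x 1 ^ 2 - x 2 ^ 2)) → ∀ (σ : ℝ) (g : ℝ → ℝ), (σ = 1 ∨ σ = -1) → ContDiff ℝ ∞ g → StrictMono g → (∀ t, 0 < deriv g t) → g 0 = 0 → (∀ t, |g t| < Real.pi / 2) → ∃ (s₁ s₂ ε₂ : ℝ) (ιC : ((Metric.sphere (0 : 𝔼 2) 1) × (Metric.sphere (0 : 𝔼 2) 1)) × ((Metric.sphere (0 : 𝔼 2) 1) × ℝ) → X) (aC bC : X →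 (Metric.sphere (0 : 𝔼 2) 1)), 0 < s₁ ∧ s₁ < s₂ ∧ 0 < ε₂ ∧ ε₂ ≤ ε ∧ s₂ < ε₂ ^ 2 / 4 ∧ ContMDiffOn (((𝓡 1).prod (𝓡 1)).prod ((𝓡 1).prod 𝓘(ℝ, ℝ))) (𝓡 4) ∞ ιC (Set.univ ×ˢ (Set.univ ×ˢ Set.Ioo s₁ s₂)) ∧ (∀ (a b u : Metric.sphere (0 : 𝔼 2) 1) (s : ℝ), s₁ < s → s < s₂ → ((f (ιC ((a, b), (u, s))) : 𝕊²) : 𝔼 3) 0 = √(1 - s ^ 2) * (u : 𝔼 2) 0 ∧ ((f (ιC ((a, b), (u, s))) : 𝕊²) : 𝔼 3) 1 = √(1 - s ^ 2) * (u : 𝔼 2) 1 ∧ ((f (ιC ((a, b), (u, s))) : 𝕊²) : 𝔼 3) 2 = (v : 𝔼 3) 2 * s ∧ aC (ιC ((a, b), (u, s))) = a ∧ bC (ιC ((a, b), (u, s))) = b) ∧ ContMDiffOn (𝓡 4) (𝓡 1) ∞ aC {x | s₁ < (v : 𝔼 3) 2 * ((f x : 𝕊²) : 𝔼 3) 2 ∧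 (v : 𝔼 3) 2 * ((f x : 𝕊²) : 𝔼 3) 2 < s₂} ∧ ContMDiffOn (𝓡 4) (𝓡 1) ∞ bC {x | s₁ < (v : 𝔼 3) 2 * ((f x : 𝕊²) : 𝔼 3) 2 ∧ (v : 𝔼 3) 2 * ((f x : 𝕊²) : 𝔼 3) 2 < s₂} ∧ (∀ x : X, s₁ < (v : 𝔼 3) 2 * ((f x : 𝕊²) : 𝔼 3) 2 → (v : 𝔼 3) 2 * ((f x : 𝕊²) : 𝔼 3) 2 < s₂ → ∃ u : Metric.sphere (0 : 𝔼 2) 1, ιC ((aC x, bC x), (u, (v : 𝔼 3) 2 * ((f x : 𝕊²) : 𝔼 3) 2)) = x) ∧ (∀ (u : Metric.sphere (0 : 𝔼 2) 1) (x : 𝔼 3), x ∈ Metric.ball (0 : 𝔼 3) ε₂ → s₁ < x 0 ^ 2 + x 1 ^ 2 - x 2 ^ 2 → x 0 ^ 2 + x 1 ^ 2 - x 2 ^ 2 < s₂ → ((aC (ν (u, x)) : Metric.sphere (0 : 𝔼 2) 1) : 𝔼 2) 0 = Real.cos (g (x 2)) * (u : 𝔼 2) 0 + σ * Real.sin (g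 (x 2)) * (u : 𝔼 2) 1 ∧ ((aC (ν (u, x)) : Metric.sphere (0 : 𝔼 2) 1) : 𝔼 2) 1 = -Real.sin (g (x 2)) * (u : 𝔼 2) 0 + σ * Real.cos (g (x 2)) * (u : 𝔼 2) 1) := by
  sorry

/-! ### Stub 7a-Ang-D (apex leaf F0) — the degree lemma -/

/-- **Leaf: the degree of the loop of vanishing cycles is `±1`** — read along a base circle of the
torus-side product, the rigid angular coordinate of one of the two signed collars lifts
periodically — because `H₁(X; ℤ) ≅ ℤ/deg` (Mayer–Vietoris for the torus tube and its complement)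
while `H₁(X) = 0` for simply connected `X`. [cite: BaykurKamada2015, Lemma 11, Cor. 14]
[cite: HatcherAT2002, §2.2] -/
theorem helper_sliceGluing_vanishingDegree :
    ∀ (X : Type) [TopologicalSpace X] [T2Space X] [SecondCountableTopology X] [CompactSpace X] [ChartedSpace (𝔼 4) X] [IsManifold (𝓡 4) ∞ X] [SimplyConnectedSpace X] (o : SmoothOrientation (𝓡 4) X) (f : X → 𝕊²), IsSimplifiedBrokenLefschetzFibration o f ∅ 0 → f '' ({p : X | ¬ Surjective (mfderiv (𝓡 4) (𝓡 2) f p)} \ (↑(∅ : Finset X) : Set X)) = sphereEquator 1 → ∀ (v : 𝕊²), (v : 𝔼 3) 0 = 0 → (v : 𝔼 3) 1 = 0 → (∀ y : 𝕊², ⟪(y : 𝔼 3), (v : 𝔼 3)⟫ < 0 → (∀ q, f q = y → Surjective (mfderiv (𝓡 4) (𝓡 2) f q)) ∧ Nonempty ((Fin (2 * 0) → ℤ) ≃ₗ[ℤ] singularHomology ℤ ℤ ↥(f ⁻¹' {y}) 1)) → (∀ y : 𝕊², ⟪(y : 𝔼 3), ((-v : 𝕊²) : 𝔼 3)⟫ <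 0 → (∀ q, f q = y → Surjective (mfderiv (𝓡 4) (𝓡 2) f q)) ∧ Nonempty ((Fin (2 * (0 + 1)) → ℤ) ≃ₗ[ℤ] singularHomology ℤ ℤ ↥(f ⁻¹' {y}) 1)) → ∀ (ε : ℝ) (ν : (Metric.sphere (0 : 𝔼 2) 1) × 𝔼 3 → X), IsFoldTube f v ε ν → ∀ (Fb : Type) [TopologicalSpace Fb] [T2Space Fb] [SecondCountableTopology Fb] [CompactSpace Fb] [ConnectedSpace Fb] [ChartedSpace (𝔼 2) Fb] [IsManifold (𝓡 2) ∞ Fb] (ιT : Fb × 𝔼 2 → X), IsTorusSideProduct f v ιT → ∀ (s₁ s₂ ε₂ s₁' s₂' ε₂' : ℝ) (ιC ιC' : ((Metric.sphere (0 : 𝔼 2) 1) × (Metric.sphere (0 : 𝔼 2) 1)) × ((Metric.sphere (0 : 𝔼 2) 1) × ℝ) → X) (aC bC aC' bC' : X → Metric.sphere (0 : 𝔼 2) 1), IsRigidCollar f v ν 1 Real.arctan s₁ s₂ ε₂ ιC aC bC → IsRigidCollar f v ν (-1) Real.arctan s₁' s₂' ε₂' ιC' aC' bC' → ε₂ ≤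 ε → ε₂' ≤ ε → (∀ (θ : Fb) (R : ℝ), 0 < R → (∀ t : ℝ, s₁ < (v : 𝔼 3) 2 * ((f (ιT (θ, R • ((circlePt t : Metric.sphere (0 : 𝔼 2) 1) : 𝔼 2))) : 𝕊²) : 𝔼 3) 2 ∧ (v : 𝔼 3) 2 * ((f (ιT (θ, R • ((circlePt t : Metric.sphere (0 : 𝔼 2) 1) : 𝔼 2))) : 𝕊²) : 𝔼 3) 2 < s₂) → ∃ L : ℝ → ℝ, Continuous L ∧ (∀ t, L (t + 1) = L t) ∧ ∀ t : ℝ, aC (ιT (θ, R • ((circlePt t : Metric.sphere (0 : 𝔼 2) 1) : 𝔼 2))) = circlePt (L t)) ∨ (∀ (θ : Fb) (R : ℝ), 0 < R → (∀ t : ℝ, s₁' < (v : 𝔼 3) 2 * ((f (ιT (θ, R • ((circlePt t : Metric.sphere (0 : 𝔼 2) 1) : 𝔼 2))) : 𝕊²) : 𝔼 3) 2 ∧ (v : 𝔼 3) 2 * ((f (ιT (θ, R • ((circlePt t : Metric.sphere (0 : 𝔼 2) 1) : 𝔼 2))) : 𝕊²) : 𝔼 3) 2 < s₂') → ∃ L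 : ℝ → ℝ, Continuous L ∧ (∀ t, L (t + 1) = L t) ∧ ∀ t : ℝ, aC' (ιT (θ, R • ((circlePt t : Metric.sphere (0 : 𝔼 2) 1) : 𝔼 2))) = circlePt (L t)) := by
  sorry

/-! ### Stub 7a-Ang-E (apex leaf DX) — extension over the torus disc -/

/-- **Leaf: extension of the rigid angular coordinate over the torus disc**, given the degree
condition, by Earle–Eells-lite: compare the rigid band trivialisation with the disc product
(a loop in `Diff(T²)`), deform it to its translation loop through based loops
(`gramain_loopHomotopy_translationLoop_torus`), and interpolate radially down to a fixed
fibration near the polar fibre. [cite: Gramain1973, Théorème 1] [cite: EarleEells1969] -/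
theorem helper_sliceGluing_discExtension :
    gramain_loopHomotopy_translationLoop_torus → ∀ (X : Type) [TopologicalSpace X] [T2Space X] [SecondCountableTopology X] [CompactSpace X] [ChartedSpace (𝔼 4) X] [IsManifold (𝓡 4) ∞ X] (o : SmoothOrientation (𝓡 4) X) (f : X → 𝕊²), IsSimplifiedBrokenLefschetzFibration o f ∅ 0 → f '' ({p : X | ¬ Surjective (mfderiv (𝓡 4) (𝓡 2) f p)} \ (↑(∅ : Finset X) : Set X)) = sphereEquator 1 → ∀ (v : 𝕊²), (v : 𝔼 3) 0 = 0 → (v : 𝔼 3) 1 = 0 → (∀ y : 𝕊², ⟪(y : 𝔼 3), (v : 𝔼 3)⟫ < 0 → (∀ q, f q = y → Surjective (mfderiv (𝓡 4) (𝓡 2) f q)) ∧ Nonempty ((Fin (2 * 0) → ℤ) ≃ₗ[ℤ] singularHomology ℤ ℤ ↥(f ⁻¹' {y}) 1)) → (∀ y : 𝕊², ⟪(y : 𝔼 3), ((-v : 𝕊²) : 𝔼 3)⟫ < 0 → (∀ q, f q = y → Surjective (mfderiv (𝓡 4) (𝓡 2) f q)) ∧ Nonempty ((Fin (2 * (0 +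 1)) → ℤ) ≃ₗ[ℤ] singularHomology ℤ ℤ ↥(f ⁻¹' {y}) 1)) → ∀ (ε : ℝ) (ν : (Metric.sphere (0 : 𝔼 2) 1) × 𝔼 3 → X), IsFoldTube f v ε ν → ∀ (Fb : Type) [TopologicalSpace Fb] [T2Space Fb] [SecondCountableTopology Fb] [CompactSpace Fb] [ConnectedSpace Fb] [ChartedSpace (𝔼 2) Fb] [IsManifold (𝓡 2) ∞ Fb] (ιT : Fb × 𝔼 2 → X), IsTorusSideProduct f v ιT → ∀ (σ s₁ s₂ ε₂ : ℝ) (ιC : ((Metric.sphere (0 : 𝔼 2) 1) × (Metric.sphere (0 : 𝔼 2) 1)) × ((Metric.sphere (0 : 𝔼 2) 1) × ℝ) → X) (aC bC : X → Metric.sphere (0 : 𝔼 2) 1), (σ = 1 ∨ σ = -1) → IsRigidCollar f v ν σ Real.arctan s₁ s₂ ε₂ ιC aC bC → ε₂ ≤ ε → (∀ (θ : Fb) (R : ℝ), 0 < R → (∀ t : ℝ, s₁ < (v : 𝔼 3) 2 * ((f (ιT (θ, R • ((circlePt t : Metric.sphere (0 : 𝔼 2) 1) : 𝔼 2))) : 𝕊²)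 : 𝔼 3) 2 ∧ (v : 𝔼 3) 2 * ((f (ιT (θ, R • ((circlePt t : Metric.sphere (0 : 𝔼 2) 1) : 𝔼 2))) : 𝕊²) : 𝔼 3) 2 < s₂) → ∃ L : ℝ → ℝ, Continuous L ∧ (∀ t, L (t + 1) = L t) ∧ ∀ t : ℝ, aC (ιT (θ, R • ((circlePt t : Metric.sphere (0 : 𝔼 2) 1) : 𝔼 2))) = circlePt (L t)) → ∃ (sA sB : ℝ) (A : X → Metric.sphere (0 : 𝔼 2) 1), IsTorusAngular f v ν σ sA sB ε₂ A ∧ (∀ (u : Metric.sphere (0 : 𝔼 2) 1) (x : 𝔼 3) (z : X), x ∈ Metric.ball (0 : 𝔼 3) ε₂ → sA < x 0 ^ 2 + x 1 ^ 2 - x 2 ^ 2 → x 0 ^ 2 + x 1 ^ 2 - x 2 ^ 2 < sB → f z = f (ν (u, x)) → A z = A (ν (u, x)) → z ∈ ν '' ({u} ×ˢ Metric.ball (0 : 𝔼 3) ε₂)) := by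
  sorry

/-! ### Stub 7a-Ang (apex brick F2') — the torus-side angular coordinate matched to the fold tube -/

/-- **Brick F2': a fibrewise-submersive circle-valued map `A` on the torus region matched
linearly to the fold tube** (`A(ν(u, x)) = R(-arctan x₂)(u₀, σ u₁)` on a band): rigid torus
coordinates on a collar (families isotopy extension, the annulus twist lemma, torus recognition
rel an annulus from the sphere side) and extension of the loop of circle fibrations over the torus
disc (Earle–Eells-lite; the degree of the vanishing-cycle loop is `±1` because `H₁(X) = 0`).
[cite: Gramain1973, Théorème 1] [cite: BaykurKamada2015, §5] [cite: FarbMargalit2012, Prop. 2.4] -/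
theorem helper_sliceGluing_torusAngular :
    gramain_loopHomotopy_translationLoop_torus → ∀ (X : Type) [TopologicalSpace X] [T2Space X] [SecondCountableTopology X] [CompactSpace X] [ChartedSpace (𝔼 4) X] [IsManifold (𝓡 4) ∞ X] [SimplyConnectedSpace X] (o : SmoothOrientation (𝓡 4) X) (f : X → 𝕊²), IsSimplifiedBrokenLefschetzFibration o f ∅ 0 → f '' ({p : X | ¬ Surjective (mfderiv (𝓡 4) (𝓡 2) f p)} \ (↑(∅ : Finset X) : Set X)) = sphereEquator 1 → ∀ (v : 𝕊²), (v : 𝔼 3) 0 = 0 → (v : 𝔼 3) 1 = 0 → (∀ y : 𝕊², ⟪(y : 𝔼 3), (v : 𝔼 3)⟫ < 0 → (∀ q, f q = y → Surjective (mfderiv (𝓡 4) (𝓡 2) f q)) ∧ Nonempty ((Fin (2 * 0) → ℤ) ≃ₗ[ℤ] singularHomology ℤ ℤ ↥(f ⁻¹' {y}) 1)) → (∀ y : 𝕊², ⟪(y : 𝔼 3), ((-v : 𝕊²) : 𝔼 3)⟫ < 0 → (∀ q, f q = y → Surjective (mfderiv (𝓡 4) (𝓡 2) f q)) ∧ Nonempty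 ((Fin (2 * (0 + 1)) → ℤ) ≃ₗ[ℤ] singularHomology ℤ ℤ ↥(f ⁻¹' {y}) 1)) → ∀ (ε : ℝ) (ν : (Metric.sphere (0 : 𝔼 2) 1) × 𝔼 3 → X), 0 < ε → ε < 1 → ContMDiffOn ((𝓡 1).prod 𝓘(ℝ, 𝔼 3)) (𝓡 4) ∞ ν (Set.univ ×ˢ Metric.ball 0 ε) → Set.InjOn ν (Set.univ ×ˢ Metric.ball 0 ε) → IsOpen (ν '' (Set.univ ×ˢ Metric.ball 0 ε)) → (∀ p : (Metric.sphere (0 : 𝔼 2) 1) × 𝔼 3, p.2 ∈ Metric.ball (0 : 𝔼 3) ε → Function.Injective (mfderiv ((𝓡 1).prod 𝓘(ℝ, 𝔼 3)) (𝓡 4) ν p)) → (∀ q : X, ¬ Surjective (mfderiv (𝓡 4) (𝓡 2) f q) ↔ ∃ u, ν (u, 0) = q) → (∀ (u : Metric.sphere (0 : 𝔼 2) 1) (x : 𝔼 3), x ∈ Metric.ball (0 : 𝔼 3) ε → ((f (ν (u, x)) : 𝕊²) : 𝔼 3) 0 = √(1 - (x 0 ^ 2 + x 1 ^ 2 - x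 2 ^ 2) ^ 2) * (u : 𝔼 2) 0 ∧ ((f (ν (u, x)) : 𝕊²) : 𝔼 3) 1 = √(1 - (x 0 ^ 2 + x 1 ^ 2 - x 2 ^ 2) ^ 2) * (u : 𝔼 2) 1 ∧ ((f (ν (u, x)) : 𝕊²) : 𝔼 3) 2 = (v : 𝔼 3) 2 * (x 0 ^ 2 + x 1 ^ 2 - x 2 ^ 2)) → ∃ (σ sA sB ε₂ : ℝ) (A : X → (Metric.sphere (0 : 𝔼 2) 1)), (σ = 1 ∨ σ = -1) ∧ 0 < sA ∧ sA < sB ∧ 0 < ε₂ ∧ ε₂ ≤ ε ∧ sB < ε₂ ^ 2 / 4 ∧ ContMDiffOn (𝓡 4) (𝓡 1) ∞ A {x | sA < (v : 𝔼 3) 2 * ((f x : 𝕊²) : 𝔼 3) 2} ∧ (∀ x : X, sA < (v : 𝔼 3) 2 * ((f x : 𝕊²) : 𝔼 3) 2 → ∃ y : 𝔼 4, mfderiv (𝓡 4) (𝓡 2) f x y = 0 ∧ mfderiv (𝓡 4) (𝓡 1) A x y ≠ 0) ∧ (∀ (u : Metric.sphere (0 : 𝔼 2) 1) (x : 𝔼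 3), x ∈ Metric.ball (0 : 𝔼 3) ε₂ → sA < x 0 ^ 2 + x 1 ^ 2 - x 2 ^ 2 → x 0 ^ 2 + x 1 ^ 2 - x 2 ^ 2 < sB → ((A (ν (u, x)) : Metric.sphere (0 : 𝔼 2) 1) : 𝔼 2) 0 = Real.cos (Real.arctan (x 2)) * (u : 𝔼 2) 0 + σ * Real.sin (Real.arctan (x 2)) * (u : 𝔼 2) 1 ∧ ((A (ν (u, x)) : Metric.sphere (0 : 𝔼 2) 1) : 𝔼 2) 1 = -Real.sin (Real.arctan (x 2)) * (u : 𝔼 2) 0 + σ * Real.cos (Real.arctan (x 2)) * (u : 𝔼 2) 1) ∧ (∀ (u : Metric.sphere (0 : 𝔼 2) 1) (x : 𝔼 3) (z : X), x ∈ Metric.ball (0 : 𝔼 3) ε₂ → sA < x 0 ^ 2 + x 1 ^ 2 - x 2 ^ 2 → x 0 ^ 2 + x 1 ^ 2 - x 2 ^ 2 < sB → f z = f (ν (u, x)) → A z = A (ν (u, x)) → z ∈ ν '' ({u} ×ˢ Metric.ball (0 : 𝔼 3) ε₂)) := by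
  intro hEE X _ _ _ _ _ _ _ o f hf hC v hv0 hv1 hlo hhi ε ν hε hε1 hνs hνi hνo hνd hνz hνf
  have hT : IsFoldTube f v ε ν := ⟨hε, hε1, hνs, hνi, hνo, hνd, hνz, hνf⟩
  have hg : ContDiff ℝ ∞ Real.arctan := Real.contDiff_arctan
  have hgm : StrictMono Real.arctan := Real.arctan_strictMono
  have hg0 : Real.arctan 0 = 0 := Real.arctan_zero
  have hgb : ∀ t, |Real.arctan t| < Real.pi / 2 := fun t =>
    abs_lt.2 ⟨Real.neg_pi_div_two_lt_arctan t, Real.arctan_lt_pi_div_two t⟩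
  have hgd : ∀ t, 0 < deriv Real.arctan t := fun t => by
    rw [Real.deriv_arctan]; positivity
  -- rigid collars for both signs
  obtain ⟨s₁, s₂, ε₂, ιC, aC, bC, h1, h2, h3, h4, h5, h6, h7, h8, h9, h10, h11⟩ :=
    helper_sliceGluing_rigidCollar X o f hf hC v hv0 hv1 hlo hhi ε ν hε hε1 hνs hνi hνo hνd hνz hνf
      1 Real.arctan (Or.inl rfl) hg hgm hgd hg0 hgb
  obtain ⟨s₁', s₂', ε₂', ιC', aC', bC', h1', h2', h3', h4', h5', h6', h7', h8', h9', h10', h11'⟩ :=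
    helper_sliceGluing_rigidCollar X o f hf hC v hv0 hv1 hlo hhi ε ν hε hε1 hνs hνi hνo hνd hνz hνf
      (-1) Real.arctan (Or.inr rfl) hg hgm hgd hg0 hgb
  have hRC : IsRigidCollar f v ν 1 Real.arctan s₁ s₂ ε₂ ιC aC bC :=
    ⟨h1, h2, h3, h5, h6, h7, h8, h9, h10, fun u x hx ha hb => ?_⟩
  swap
  · obtain ⟨e0, e1⟩ := h11 u x hx ha hb
    ext i; fin_cases i
    · simpa using e0
    · simpa using e1
  have hRC' : IsRigidCollar f v ν (-1) Real.arctan s₁' s₂' ε₂' ιC' aC' bC' :=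
    ⟨h1', h2', h3', h5', h6', h7', h8', h9', h10', fun u x hx ha hb => ?_⟩
  swap
  · obtain ⟨e0, e1⟩ := h11' u x hx ha hb
    ext i; fin_cases i
    · simpa using e0
    · simpa using e1
  -- the torus side as a product
  obtain ⟨Fb, _, _, _, _, _, _, _, ιT, hemb, hrange, hι0, hι0r, hιf⟩ :=
    hf.exists_isSmoothEmbedding_prod_range_eq_preimage_hemisphere hC (-v) (by simpa using hv0)
      (by simpa using hv1)
  have hneg : -(-v) = v := neg_neg v
  have hTS : IsTorusSideProduct f v ιT := ⟨hemb, hrange, hι0, hι0r, hιf⟩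
  -- the degree of the loop of vanishing cycles is `±1` for one of the two signs
  rcases helper_sliceGluing_vanishingDegree X o f hf hC v hv0 hv1 hlo hhi ε ν hT Fb ιT hTS s₁ s₂ ε₂
      s₁' s₂' ε₂' ιC ιC' aC bC aC' bC' hRC hRC' h4 h4' with hL | hL
  · obtain ⟨sA, sB, A, hA, hAlev⟩ := helper_sliceGluing_discExtension hEE X o f hf hC v hv0 hv1 hlo hhi ε ν
      hT Fb ιT hTS 1 s₁ s₂ ε₂ ιC aC bC (Or.inl rfl) hRC h4 hL
    refine ⟨1, sA, sB, ε₂, A, Or.inl rfl, hA.pos, hA.lt, hA.ε₂_pos, h4, hA.lt_sq, hA.contMDiffOn,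
      hA.submersive, fun u x hx ha hb => ?_, hAlev⟩
    have e := hA.rigid u x hx ha hb
    exact ⟨by simpa using congrArg (fun z : 𝔼 2 => z 0) e,
      by simpa using congrArg (fun z : 𝔼 2 => z 1) e⟩
  · obtain ⟨sA, sB, A, hA, hAlev⟩ := helper_sliceGluing_discExtension hEE X o f hf hC v hv0 hv1 hlo hhi ε ν
      hT Fb ιT hTS (-1) s₁' s₂' ε₂' ιC' aC' bC' (Or.inr rfl) hRC' h4' hL
    refine ⟨-1, sA, sB, ε₂', A, Or.inr rfl, hA.pos, hA.lt, hA.ε₂_pos, h4', hA.lt_sq, hA.contMDiffOn,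
      hA.submersive, fun u x hx ha hb => ?_, hAlev⟩
    have e := hA.rigid u x hx ha hb
    exact ⟨by simpa using congrArg (fun z : 𝔼 2 => z 0) e,
      by simpa using congrArg (fun z : 𝔼 2 => z 1) e⟩

/-! ### Stub 7a-F3 (apex brick F3) — construction of the Morse–Bott function and the angular map -/

/-- **Brick F3: the construction** of `F = c₁ P(h) [μ(h) ⟪u, A⟫ - (1 - μ(h)) K]` off the fold tube,
`F = c₁ P(Q) cos(arctan x₂)` on it, and `α = u - λ(h) (u - a)˜`, with the transport of `A` across
the equator off the tube by a `u`-preserving unit-`h` field radial inside the tube; all critical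
point, Bott and submersion checks are local algebra (lead's design, `Cruxes/RungOne/NOTES.md`,
"Apex design III"). [cite: Milnor1963, §2–3] [cite: BanyagaHurtubise2004, Thm. 2] -/
theorem helper_sliceGluing_bottConstruction :
    ∀ (X : Type) [TopologicalSpace X] [T2Space X] [SecondCountableTopology X] [CompactSpace X] [ChartedSpace (𝔼 4) X] [IsManifold (𝓡 4) ∞ X] (o : SmoothOrientation (𝓡 4) X) (f : X → 𝕊²), IsSimplifiedBrokenLefschetzFibration o f ∅ 0 → ∀ (v : 𝕊²) (ιX : 𝕊² × 𝔼 2 → X), (v : 𝔼 3) 0 = 0 → (v : 𝔼 3) 1 = 0 → Manifold.IsSmoothEmbedding ((𝓡 2).prod (𝓡 2)) (𝓡 4) ∞ ιX → range ιX = f ⁻¹' {y : 𝕊² | ⟪(y : 𝔼 3), (v : 𝔼 3)⟫ < 0} → (∀ p, f (ιX p) = (stereographic' 2 v).symm (OpenPartialHomeomorph.univBall (0 : 𝔼 2) 2 p.2)) → ∀ (ε : ℝ) (ν : (Metric.sphere (0 : 𝔼 2) 1) × 𝔼 3 → X), 0 < ε → ε < 1 → ContMDiffOn ((𝓡 1).prod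 𝓘(ℝ, 𝔼 3)) (𝓡 4) ∞ ν (Set.univ ×ˢ Metric.ball 0 ε) → Set.InjOn ν (Set.univ ×ˢ Metric.ball 0 ε) → IsOpen (ν '' (Set.univ ×ˢ Metric.ball 0 ε)) → (∀ p : (Metric.sphere (0 : 𝔼 2) 1) × 𝔼 3, p.2 ∈ Metric.ball (0 : 𝔼 3) ε → Function.Injective (mfderiv ((𝓡 1).prod 𝓘(ℝ, 𝔼 3)) (𝓡 4) ν p)) → (∀ q : X, ¬ Surjective (mfderiv (𝓡 4) (𝓡 2) f q) ↔ ∃ u, ν (u, 0) = q) → (∀ (u : Metric.sphere (0 : 𝔼 2) 1) (x : 𝔼 3), x ∈ Metric.ball (0 : 𝔼 3) ε → ((f (ν (u, x)) : 𝕊²) : 𝔼 3) 0 = √(1 - (x 0 ^ 2 + x 1 ^ 2 - x 2 ^ 2) ^ 2) * (u : 𝔼 2) 0 ∧ ((f (ν (u, x)) : 𝕊²) : 𝔼 3) 1 = √(1 - (x 0 ^ 2 + x 1 ^ 2 - x 2 ^ 2) ^ 2) * (u : 𝔼 2) 1 ∧ ((f (ν (u, x)) : 𝕊²) : 𝔼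 3) 2 = (v : 𝔼 3) 2 * (x 0 ^ 2 + x 1 ^ 2 - x 2 ^ 2)) → ∀ (σ sA sB ε₂ : ℝ) (A : X → (Metric.sphere (0 : 𝔼 2) 1)), (σ = 1 ∨ σ = -1) → 0 < sA → sA < sB → 0 < ε₂ → ε₂ ≤ ε → sB < ε₂ ^ 2 / 4 → ContMDiffOn (𝓡 4) (𝓡 1) ∞ A {x | sA < (v : 𝔼 3) 2 * ((f x : 𝕊²) : 𝔼 3) 2} → (∀ x : X, sA < (v : 𝔼 3) 2 * ((f x : 𝕊²) : 𝔼 3) 2 → ∃ y : 𝔼 4, mfderiv (𝓡 4) (𝓡 2) f x y = 0 ∧ mfderiv (𝓡 4) (𝓡 1) A x y ≠ 0) → (∀ (u : Metric.sphere (0 : 𝔼 2) 1) (x : 𝔼 3), x ∈ Metric.ball (0 : 𝔼 3) ε₂ → sA < x 0 ^ 2 + x 1 ^ 2 - x 2 ^ 2 → x 0 ^ 2 + x 1 ^ 2 - x 2 ^ 2 < sB → ((A (ν (u, x)) : Metric.sphere (0 : 𝔼 2) 1) : 𝔼 2) 0 = Real.cos (Real.arctan (x 2)) * (u : 𝔼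 2) 0 + σ * Real.sin (Real.arctan (x 2)) * (u : 𝔼 2) 1 ∧ ((A (ν (u, x)) : Metric.sphere (0 : 𝔼 2) 1) : 𝔼 2) 1 = -Real.sin (Real.arctan (x 2)) * (u : 𝔼 2) 0 + σ * Real.cos (Real.arctan (x 2)) * (u : 𝔼 2) 1) → (∀ (u : Metric.sphere (0 : 𝔼 2) 1) (x : 𝔼 3) (z : X), x ∈ Metric.ball (0 : 𝔼 3) ε₂ → sA < x 0 ^ 2 + x 1 ^ 2 - x 2 ^ 2 → x 0 ^ 2 + x 1 ^ 2 - x 2 ^ 2 < sB → f z = f (ν (u, x)) → A z = A (ν (u, x)) → z ∈ ν '' ({u} ×ˢ Metric.ball (0 : 𝔼 3) ε₂)) → ∃ (F : X → ℝ) (a' a b : ℝ) (_ : IsRegularLevel (𝓡 4) F a) (e : (Metric.sphere (0 : 𝔼 2) 1) → X) (α : X → 𝔼 2), a' < a ∧ a < b ∧ Manifold.IsSmoothEmbedding (𝓡 1) (𝓡 4) ∞ e ∧ (∀ x, a ≤ F x → F x ≤ b) ∧ (∀ x, a ≤ F x → (IsMCriticalPt (𝓡 4) F x ↔ x ∈ range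 e)) ∧ (∀ u, F (e u) = b) ∧ (∀ (u : Metric.sphere (0 : 𝔼 2) 1) (w : 𝔼 4), mhessian (𝓡 4) F (e u) w w ≤ 0 ∧ (mhessian (𝓡 4) F (e u) w w = 0 → w ∈ range (mfderiv (𝓡 1) (𝓡 4) e u))) ∧ ContMDiffOn (𝓡 4) 𝓘(ℝ, 𝔼 2) ∞ α {x | a' < F x} ∧ (∀ x, a' < F x → ‖α x‖ = 1) ∧ (∀ u : Metric.sphere (0 : 𝔼 2) 1, α (e u) = (u : 𝔼 2)) ∧ (∀ x, a ≤ F x → x ∉ range e → ∀ (r : ℝ) (w : 𝔼 2), ⟪w, α x⟫ = 0 → ∃ y : 𝔼 4, mfderiv (𝓡 4) 𝓘(ℝ, ℝ) F x y = r ∧ mfderiv (𝓡 4) 𝓘(ℝ, 𝔼 2) α x y = w) ∧ ((fun y => (-1 / 2 : ℝ) - (SphereHeight.height (v : 𝔼 3) ∘ f) y) ⁻¹' Set.Iic 0 = (fun y => a - F y) ⁻¹' Set.Iic 0) ∧ (∀ x, (SphereHeight.height (v : 𝔼 3) ∘ f) x = -1 / 2 → F x = a) ∧ (∀ p : 𝕊²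 × 𝔼 2, (SphereHeight.height (v : 𝔼 3) ∘ f) (ιX p) = -1 / 2 → α (ιX p) = (√2 : ℝ) • p.2 ∧ ‖p.2‖ ^ 2 = 1 / 2) := by
  sorry

/-! ### Stub 7a (apex brick F) — the Morse–Bott function with maximum circle the round locus -/

/-- **Apex brick F: a Morse–Bott function on `X` whose superlevel `{a ≤ F}` is the complement
`K = {⟪v, f⟫ ≥ -1/2}` of the sphere tube, whose only critical set in `K` is the round circle `Z`
(a Bott-nondegenerate maximum), together with a unit "angular" map `α` with `α ∘ e = id`,
`(F, α)` a submersion off `Z`, and `α = √2 · w` on `∂K`.**  Construction (lead's design,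
`Cruxes/RungOne/NOTES.md`, "Apex design III"): in the `S¹`-parametric fold normal form
`ν(u, x)` of `Z` (`f ∘ ν = (√(1 - Q²) u, v₂ Q)`, `Q = x₀² + x₁² - x₂²`) and rigid torus-side
coordinates `(a, b)` matched to it (`a = u - g(x₂)` on the tube; Earle–Eells-lite straightens
the loop of vanishing cycles, its degree is `±1` because `π₁(X) = 1`), transported across the
equator off the tube by a bordered Ehresmann flow, put
`F = c₁ P(h) [μ(h) cos(u - a) - (1 - μ(h)) K]` off the tube and `F = c₁ P(Q) cos g(x₂)` on it
(`P` strictly decreasing, `μ` a plateau, `K > 1`), and `α = u - λ(h) (u - a)˜`; all critical-point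
and submersion checks are local algebra.
[cite: AurouxDonaldsonKatzarkov2005, §8.2 Example 1] [cite: BaykurKamada2015, §5, Lemma 11]
[cite: Gramain1973, Théorème 1] [cite: BanyagaHurtubise2004, Thm. 2] -/
theorem helper_sliceGluing_bottFunction :
    gramain_loopHomotopy_translationLoop_torus →
    ∀ (X : Type) [TopologicalSpace X] [T2Space X] [SecondCountableTopology X] [CompactSpace X]
      [ChartedSpace (𝔼 4) X] [IsManifold (𝓡 4) ∞ X] [SimplyConnectedSpace X]
      (o : SmoothOrientation (𝓡 4) X) (f : X → 𝕊²),
      IsSimplifiedBrokenLefschetzFibration o f ∅ 0 →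
      f '' ({p : X | ¬ Surjective (mfderiv (𝓡 4) (𝓡 2) f p)} \ (↑(∅ : Finset X) : Set X)) =
        sphereEquator 1 →
      ∀ (v : 𝕊²) (ιX : 𝕊² × 𝔼 2 → X), (v : 𝔼 3) 0 = 0 → (v : 𝔼 3) 1 = 0 →
      Manifold.IsSmoothEmbedding ((𝓡 2).prod (𝓡 2)) (𝓡 4) ∞ ιX →
      range ιX = f ⁻¹' {y : 𝕊² | ⟪(y : 𝔼 3), (v : 𝔼 3)⟫ < 0} →
      (∀ p, f (ιX p) = (stereographic' 2 v).symm
        (OpenPartialHomeomorph.univBall (0 : 𝔼 2) 2 p.2)) →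
      (∀ y : 𝕊², ⟪(y : 𝔼 3), ((-v : 𝕊²) : 𝔼 3)⟫ < 0 →
        (∀ q, f q = y → Surjective (mfderiv (𝓡 4) (𝓡 2) f q)) ∧
        Module.finrank ℤ (singularHomology ℤ ℤ ↥(f ⁻¹' {y}) 1) = 2) →
      ∃ (F : X → ℝ) (a' a b : ℝ) (_ : IsRegularLevel (𝓡 4) F a)
        (e : (Metric.sphere (0 : 𝔼 2) 1) → X) (α : X → 𝔼 2),
        a' < a ∧ a < b ∧ Manifold.IsSmoothEmbedding (𝓡 1) (𝓡 4) ∞ e ∧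
        (∀ x, a ≤ F x → F x ≤ b) ∧
        (∀ x, a ≤ F x → (IsMCriticalPt (𝓡 4) F x ↔ x ∈ range e)) ∧
        (∀ u, F (e u) = b) ∧
        (∀ (u : Metric.sphere (0 : 𝔼 2) 1) (w : 𝔼 4), mhessian (𝓡 4) F (e u) w w ≤ 0 ∧
          (mhessian (𝓡 4) F (e u) w w = 0 → w ∈ range (mfderiv (𝓡 1) (𝓡 4) e u))) ∧
        ContMDiffOn (𝓡 4) 𝓘(ℝ, 𝔼 2) ∞ α {x | a' < F x} ∧
        (∀ x, a' < F x → ‖α x‖ = 1) ∧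
        (∀ u : Metric.sphere (0 : 𝔼 2) 1, α (e u) = (u : 𝔼 2)) ∧
        (∀ x, a ≤ F x → x ∉ range e → ∀ (r : ℝ) (w : 𝔼 2), ⟪w, α x⟫ = 0 →
          ∃ y : 𝔼 4, mfderiv (𝓡 4) 𝓘(ℝ, ℝ) F x y = r ∧ mfderiv (𝓡 4) 𝓘(ℝ, 𝔼 2) α x y = w) ∧
        ((fun y => (-1 / 2 : ℝ) - (SphereHeight.height (v : 𝔼 3) ∘ f) y) ⁻¹' Set.Iic 0 =
          (fun y => a - F y) ⁻¹' Set.Iic 0) ∧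
        (∀ x, (SphereHeight.height (v : 𝔼 3) ∘ f) x = -1 / 2 → F x = a) ∧
        (∀ p : 𝕊² × 𝔼 2, (SphereHeight.height (v : 𝔼 3) ∘ f) (ιX p) = -1 / 2 →
          α (ιX p) = (√2 : ℝ) • p.2 ∧ ‖p.2‖ ^ 2 = 1 / 2) := by
  intro hEE X _ _ _ _ _ _ _ o f hf hC v ιX hv0 hv1 hemb hrange hιf hhi
  -- the pole of `exists_pole_lower_higher_sides` is `v`
  obtain ⟨v', hv0', hv1', hlo', hhi'⟩ := hf.exists_pole_lower_higher_sides hC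
  have hvv : v' = v := by
    by_contra hne
    -- `v' = -v`: both are `(0, 0, ±1)`
    have h3 : ∀ w : 𝕊², (w : 𝔼 3) 0 = 0 → (w : 𝔼 3) 1 = 0 → (w : 𝔼 3) 2 = 1 ∨ (w : 𝔼 3) 2 = -1 := by
      intro w h0 h1
      have hn : ‖(w : 𝔼 3)‖ = 1 := by simp
      have hsq : (w : 𝔼 3) 2 ^ 2 = 1 := by
        have := EuclideanSpace.norm_sq_eq (w : 𝔼 3)
        rw [hn] at this
        simp [Fin.sum_univ_three, h0, h1, sq_abs] at this
        linarith
      have h1' : ((w : 𝔼 3) 2 - 1) * ((w : 𝔼 3) 2 + 1) = 0 := by ring_nf; linarith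
      rcases mul_eq_zero.mp h1' with h | h
      · exact Or.inl (by linarith)
      · exact Or.inr (by linarith)
    have hext : ∀ w w' : 𝕊², (w : 𝔼 3) 0 = (w' : 𝔼 3) 0 → (w : 𝔼 3) 1 = (w' : 𝔼 3) 1 →
        (w : 𝔼 3) 2 = (w' : 𝔼 3) 2 → w = w' := by
      intro w w' e0 e1 e2
      apply Subtype.ext
      ext i
      fin_cases i
      · exact e0
      · exact e1
      · exact e2
    have hneg : v' = -v := by
      rcases h3 v' hv0' hv1' with h | h <;> rcases h3 v hv0 hv1 with h' | h'
      · exact absurd (hext v' v (by rw [hv0', hv0]) (by rw [hv1', hv1]) (by rw [h, h'])) hne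
      · apply hext <;> simp [hv0', hv0, hv1', hv1, h, h']
      · apply hext <;> simp [hv0', hv0, hv1', hv1, h, h']
      · exact absurd (hext v' v (by rw [hv0', hv0]) (by rw [hv1', hv1]) (by rw [h, h'])) hne
    -- over `y = v`: `H₁ = 0` by `hlo'` (as `⟪v, v'⟫ = -1 < 0`) but rank `2` by `hhi`
    have hin : ⟪((v : 𝕊²) : 𝔼 3), ((v' : 𝕊²) : 𝔼 3)⟫ < 0 := by
      rw [hneg]
      simp
    have hin2 : ⟪((v : 𝕊²) : 𝔼 3), ((-v : 𝕊²) : 𝔼 3)⟫ < 0 := by simp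
    obtain ⟨-, ⟨e0⟩⟩ := hlo' v hin
    obtain ⟨-, h2⟩ := hhi v hin2
    have : Module.finrank ℤ (singularHomology ℤ ℤ ↥(f ⁻¹' {v}) 1) = 0 := by
      rw [← e0.finrank_eq]; simp
    omega
  subst hvv
  obtain ⟨ε, ν, hε, hε1, hνs, hνi, hνo, hνd, hνz, hνf⟩ := helper_sliceGluing_foldNormalForm X o f hf hC v' hv0 hv1 hlo' hhi'
  obtain ⟨σ, sA, sB, ε₂, A, hσ, hsA, hAB, hε₂, hε₂ε, hsB, hAs, hAsub, hAm, hAlev⟩ :=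
    helper_sliceGluing_torusAngular hEE X o f hf hC v' hv0 hv1 hlo' hhi' ε ν hε hε1 hνs hνi hνo hνd hνz hνf
  exact helper_sliceGluing_bottConstruction X o f hf v' ιX hv0 hv1 hemb hrange hιf ε ν hε hε1 hνs hνi hνo hνd hνz hνf σ sA sB ε₂ A
    hσ hsA hAB hε₂ hε₂ε hsB hAs hAsub hAm hAlev

/-! ### Stub 7b (apex brick R) — fibred Morse–Bott recognition of the polar tube -/

/-- **Apex brick R (generic): fibred Morse–Bott recognition of the polar tube.**  On a closed
orientable `4`-manifold, a regular superlevel `{a ≤ F}` on which the only critical set of `F` is a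
Bott-nondegenerate maximum circle `e(S¹)`, equipped with a unit angular map `α` (`α ∘ e = id`,
`(F, α)` a submersion off the circle), is diffeomorphic to the polar tube `V₀` with the polar
coordinates `(x₃, x₄)` a positive multiple of `α` and the level `a` sent to `∂V₀`.  Proof plan:
gradient-like flow with first integral `α` (regular interval theorem), the periodic fibrewise
Morse lemma along the circle (`FibrewiseMorseFrame.lean`, definite case), and the explicit model
`S¹ × 𝔻³ ≅ V₀`. [cite: Milnor1963, Thm. 3.1] [cite: BanyagaHurtubise2004, Thm. 2]
[cite: HirschDT1976, Ch. 6 §1] -/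
theorem helper_sliceGluing_bottRecognition :
  ∀ (X : Type) [TopologicalSpace X] [T2Space X] [SecondCountableTopology X] [CompactSpace X] [ChartedSpace (𝔼 4) X] [IsManifold (𝓡 4) ∞ X], IsOrientable (𝓡 4) X → ∀ (F : X → ℝ) (a' a b : ℝ) (ha : IsRegularLevel (𝓡 4) F a) (e : (Metric.sphere (0 : 𝔼 2) 1) → X) (α : X → 𝔼 2), a' < a → a < b → Manifold.IsSmoothEmbedding (𝓡 1) (𝓡 4) ∞ e → (∀ x, a ≤ F x → F x ≤ b) → (∀ x, a ≤ F x → (IsMCriticalPt (𝓡 4) F x ↔ x ∈ range e)) → (∀ u, F (e u) = b) → (∀ (u : Metric.sphere (0 : 𝔼 2) 1) (w : 𝔼 4), mhessian (𝓡 4) F (e u) w w ≤ 0 ∧ (mhessian (𝓡 4) F (e u) w w = 0 → w ∈ range (mfderiv (𝓡 1) (𝓡 4) e u))) → ContMDiffOn (𝓡 4) 𝓘(ℝ, 𝔼 2) ∞ α {x | a' < F x} → (∀ x, a' < F x → ‖α x‖ = 1) → (∀ u : Metric.sphere (0 : 𝔼 2) 1, α (e u) = (u : 𝔼 2)) → (∀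 x, a ≤ F x → x ∉ range e → ∀ (r : ℝ) (w : 𝔼 2), ⟪w, α x⟫ = 0 → ∃ y : 𝔼 4, mfderiv (𝓡 4) 𝓘(ℝ, ℝ) F x y = r ∧ mfderiv (𝓡 4) 𝓘(ℝ, 𝔼 2) α x y = w) → ∃ Φ : RegularSuperlevel ha ≃ₘ⟮𝓡∂ 4, 𝓡∂ 4⟯ SphereFourSplitting.PolarTube, (∀ k : RegularSuperlevel ha, F (RegularSublevel.incl ha.const_sub k) = a → SphereFourSplitting.tubeS (SphereFourSplitting.ιV (Φ k)) = 1 / 2) ∧ ∀ k : RegularSuperlevel ha, RegularSublevel.incl ha.const_sub k ∉ range e → ∃ r : ℝ, 0 < r ∧ SphereFourSplitting.ι (SphereFourSplitting.ιV (Φ k)) 3 = r * (α (RegularSublevel.incl ha.const_sub k)) 0 ∧ SphereFourSplitting.ι (SphereFourSplitting.ιV (Φ k)) 4 = r * (α (RegularSublevel.incl ha.const_sub k)) 1 := by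
  sorry

/-! ### Stub 7 (apex) — the total space is a slice-preserving genus-one gluing -/

/-- **APEX: the complement of the sphere-side tube is the polar tube, FIBREWISE on the boundary.**
For a closed simply connected `X`, a genus-one Lefschetz-free SBLF `f` with equatorial round
image, the pole `v` and product structure `ιX` of the sphere side (as produced by
`exists_pole_isSmoothEmbedding_sphere_two_prod_side`) and the regular level `⟪v, f⟫ = -1/2`, the
superlevel `K = {⟪v, f⟫ ≥ -1/2}` (Baykur–Kamada's `W ∪ X_h`, ADK's `X_- ∪ W`) is diffeomorphic
to the polar tube `V₀ ≅ S¹ × B³` by a `Φ` carrying the boundary point `ιX (θ, w)` (`|w|² = 1/2`)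
to a point with `(x₃, x₄) = w`: every boundary fibre sphere goes to the slice over the same base
point.  (Compare the fact seat's hypothesis `hK` — `K` is a `(1,1)`-handlebody — in
`SimplifiedBrokenLefschetzSphereSideTube.lean`: this fibred form is what removes Laudenbach–Poénaru.)  Inputs: the angular submersion at the fold (Stub 1: pages bundle of the round
region) and Earle–Eells-lite (Stub 5).  Route (lead's analysis, `Cruxes/RungOne/NOTES.md`): split
`X` at the level `⟪v, f⟫ = -1/2` (`RegularSublevel.isBoundaryGluing_split`) and identify the
sphere-side tube with `W₀` FIBREWISE (`SphereSideTube.tubeDiffeomorph`, PROVED); normalise a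
neighbourhood of the round circle to the `S¹`-parametric fold model (pages bundle + Morse lemma
with parameter; the round handle is untwisted since a twisted one would give torus monodromy
`-id`); with the torus side `T_f × D` (`SimplifiedBrokenLefschetzSides`) and `T_f ≅ S¹ × S¹`,
straighten the loop of vanishing cycles to a rigid loop of translates of degree `±1` — its lift
to a loop of diffeomorphisms exists because `Stab(c) ∩ Diff₀(T²)` is connected, and has no
component outside the translations by Stub 5; the degree is `±1` by `π₁(X) = 1` — so that the
complement `K` of the sphere tube is the explicit model `T² × D² ∪ (round 2-handle along
{a = ±θ})` `≅ S¹_a × B³`, whose boundary fibre spheres are carried onto the slices by the shear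
`(a, z) ↦ (a + g(z), z)`, which extends over `S¹ × B³ ≅ V₀`.
[cite: AurouxDonaldsonKatzarkov2005, §8.2 Example 1] [cite: BaykurKamada2015, §2, §5, Lemma 11]
[cite: Hayano2011, Thm. 4.2 and Rem. 4.3] [cite: Gramain1973, Théorème 1] -/
theorem stub_sliceGluing :
    (∀ (X : Type) [TopologicalSpace X] [T2Space X] [SecondCountableTopology X] [CompactSpace X]
      [ChartedSpace (𝔼 4) X] [IsManifold (𝓡 4) ∞ X]
      (o : SmoothOrientation (𝓡 4) X) (f : X → 𝕊²),
      IsSimplifiedBrokenLefschetzFibration o f ∅ 0 →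
      f '' ({p : X | ¬ Surjective (mfderiv (𝓡 4) (𝓡 2) f p)} \ (↑(∅ : Finset X) : Set X)) =
        sphereEquator 1 →
      ∀ q : X, ¬ Surjective (mfderiv (𝓡 4) (𝓡 2) f q) →
        mfderiv (𝓡 4) 𝓘(ℝ, ℝ)
          ((fun y : 𝕊² => -(((f q : 𝕊²) : 𝔼 3) 1) * (y : 𝔼 3) 0 +
              (((f q : 𝕊²) : 𝔼 3) 0) * (y : 𝔼 3) 1) ∘ f) q ≠ 0) →
    gramain_loopHomotopy_translationLoop_torus →
    ∀ (X : Type) [TopologicalSpace X] [T2Space X] [SecondCountableTopology X] [CompactSpace X]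
      [ChartedSpace (𝔼 4) X] [IsManifold (𝓡 4) ∞ X] [SimplyConnectedSpace X]
      (o : SmoothOrientation (𝓡 4) X) (f : X → 𝕊²),
      IsSimplifiedBrokenLefschetzFibration o f ∅ 0 →
      f '' ({p : X | ¬ Surjective (mfderiv (𝓡 4) (𝓡 2) f p)} \ (↑(∅ : Finset X) : Set X)) =
        sphereEquator 1 →
      ∀ (v : 𝕊²) (ιX : 𝕊² × 𝔼 2 → X), (v : 𝔼 3) 0 = 0 → (v : 𝔼 3) 1 = 0 →
      Manifold.IsSmoothEmbedding ((𝓡 2).prod (𝓡 2)) (𝓡 4) ∞ ιX →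
      range ιX = f ⁻¹' {y : 𝕊² | ⟪(y : 𝔼 3), (v : 𝔼 3)⟫ < 0} →
      (∀ p, f (ιX p) = (stereographic' 2 v).symm
        (OpenPartialHomeomorph.univBall (0 : 𝔼 2) 2 p.2)) →
      (∀ y : 𝕊², ⟪(y : 𝔼 3), ((-v : 𝕊²) : 𝔼 3)⟫ < 0 →
        (∀ q, f q = y → Surjective (mfderiv (𝓡 4) (𝓡 2) f q)) ∧
        Module.finrank ℤ (singularHomology ℤ ℤ ↥(f ⁻¹' {y}) 1) = 2) →
      ∀ hg : IsRegularLevel (𝓡 4) (SphereHeight.height (v : 𝔼 3) ∘ f) (-1 / 2),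
      ∃ Φ : RegularSuperlevel hg ≃ₘ⟮𝓡∂ 4, 𝓡∂ 4⟯ SphereFourSplitting.PolarTube,
        ∀ (k : (𝓡∂ 4).boundary (RegularSuperlevel hg)) (p : 𝕊² × 𝔼 2),
          RegularSublevel.incl hg.const_sub k.1 = ιX p →
          SphereFourSplitting.ι (SphereFourSplitting.ιV (Φ k.1)) 3 = p.2 0 ∧
          SphereFourSplitting.ι (SphereFourSplitting.ιV (Φ k.1)) 4 = p.2 1 := by
  intro _ hEE X _ _ _ _ _ _ _ o f hf hC v ιX hv0 hv1 hemb hrange hιf hhi hg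
  obtain ⟨F, a', a, b, ha, e, α, h01, hab, he, h1, h2, h3, h4, h5, h6, h8, h7, heq, hlev, hbd⟩ :=
    helper_sliceGluing_bottFunction hEE X o f hf hC v ιX hv0 hv1 hemb hrange hιf hhi
  obtain ⟨Φ, hΦ1, hΦ2⟩ := helper_sliceGluing_bottRecognition X ⟨o⟩ F a' a b ha e α h01 hab he h1 h2 h3 h4 h5 h6 h8 h7
  let Ψ := RegularSublevel.diffeomorphOfPreimageEq hg.const_sub ha.const_sub heq
  refine ⟨Ψ.trans Φ, fun k p hk => ?_⟩
  have hΨ : RegularSublevel.incl ha.const_sub (Ψ k.1) = RegularSublevel.incl hg.const_sub k.1 := rfl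
  -- the boundary point lies on the level `⟪v, f⟫ = -1/2`, hence `F = a` there
  have hkb : (SphereHeight.height (v : 𝔼 3) ∘ f) (RegularSublevel.incl hg.const_sub k.1) = -1 / 2 := by
    have hb : (-1 / 2 : ℝ) - (SphereHeight.height (v : 𝔼 3) ∘ f)
        (RegularSublevel.incl hg.const_sub k.1) = 0 :=
      (RegularSublevel.mem_boundary_iff hg.const_sub k.1).1 k.2
    linarith
  have hFa : F (RegularSublevel.incl ha.const_sub (Ψ k.1)) = a := by
    rw [hΨ]; exact hlev _ hkb
  -- not on the critical circle (there `F = b > a`)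
  have hne : RegularSublevel.incl ha.const_sub (Ψ k.1) ∉ range e := by
    rintro ⟨u, hu⟩
    have := h3 u
    rw [hu, hFa] at this
    linarith
  obtain ⟨r, hr, hx3, hx4⟩ := hΦ2 (Ψ k.1) hne
  have htube := hΦ1 (Ψ k.1) hFa
  rw [hΨ, hk] at hx3 hx4
  obtain ⟨hα, hnorm⟩ := hbd p (hk ▸ hkb)
  rw [hα] at hx3 hx4
  have hs0 : ((√2 : ℝ) • p.2) 0 = √2 * p.2 0 := by simp
  have hs1 : ((√2 : ℝ) • p.2) 1 = √2 * p.2 1 := by simp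
  rw [hs0] at hx3
  rw [hs1] at hx4
  -- `tubeS = x₃² + x₄² = 1/2` and `x₃₄ = r √2 w`, `|w|² = 1/2` ⇒ `r √2 = 1`
  have htr : (Ψ.trans Φ) k.1 = Φ (Ψ k.1) := rfl
  have hsum : SphereFourSplitting.ι (SphereFourSplitting.ιV (Φ (Ψ k.1))) 3 ^ 2 +
      SphereFourSplitting.ι (SphereFourSplitting.ιV (Φ (Ψ k.1))) 4 ^ 2 = 1 / 2 := by
    rw [← SphereFourSplitting.tubeS_eq_coord]; exact htube
  have hw : p.2 0 ^ 2 + p.2 1 ^ 2 = 1 / 2 := by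
    rw [← hnorm, EuclideanSpace.norm_sq_eq]
    simp [Fin.sum_univ_two, sq_abs]
  have h22 : (√2 : ℝ) ^ 2 = 2 := Real.sq_sqrt zero_le_two
  have e1 : (r * (√2 * p.2 0)) ^ 2 + (r * (√2 * p.2 1)) ^ 2 =
      r ^ 2 * (√2) ^ 2 * (p.2 0 ^ 2 + p.2 1 ^ 2) := by ring
  rw [hx3, hx4, e1, h22, hw] at hsum
  have hr2 : (r * √2) * (r * √2) = 1 := by
    have : (r * √2) * (r * √2) = r ^ 2 * (√2) ^ 2 := by ring
    rw [this, h22]; linarith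
  have hpos : 0 < r * √2 := mul_pos hr (Real.sqrt_pos.2 zero_lt_two)
  have hrs : r * √2 = 1 := by
    rcases mul_self_eq_one_iff.mp hr2 with h | h
    · exact h
    · linarith
  rw [htr, hx3, hx4, ← mul_assoc, ← mul_assoc, hrs, one_mul, one_mul]
  exact ⟨rfl, rfl⟩

/-! ### The composition: the crux BY NAME from the stubs -/

/-- **`B` from the stubs (main composition, Cerf-free and Laudenbach–Poénaru-free)**: a closed
simply connected `X` carrying a genus-one Lefschetz-free SBLF is the model splitting reglued
along the slices (Stub 7, fed by Stubs 1 and 5), hence `≅ S⁴` (Stub 6).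
[cite: BaykurKamada2015, Lemma 11 and Cor. 14] -/
theorem noLefschetz_of_stubs :
    nonempty_diffeomorph_sphere_four_of_sblf_genus_one_noLefschetz := by
  intro X _ _ _ _ _ _ _ hX
  obtain ⟨o, f₀, hf₀⟩ := hX
  -- round image = equator; pole, product structure and tube of the sphere side
  obtain ⟨f, hf, hC⟩ := hf₀.exists_image_round_eq_sphereEquator
  obtain ⟨v, ιX, hv0, hv1, hemb, hrange, -, -, hιf, hhi⟩ :=
    hf.exists_pole_isSmoothEmbedding_sphere_two_prod_side hC
  have hg : IsRegularLevel (𝓡 4) (SphereHeight.height (v : 𝔼 3) ∘ f) (-1 / 2) :=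
    hf.isRegularLevel_height_comp hC hv0 hv1 (by norm_num) (by norm_num)
  let Ξ := SphereSideTube.tubeDiffeomorph hemb hrange hιf hg
  -- the fibred identification of the complement with the polar tube (Stub 7)
  obtain ⟨Φ, hΦ⟩ := stub_sliceGluing stub_angularSubmersion stub_torusLoops X o f hf hC v ιX hv0
    hv1 hemb hrange hιf hhi hg
  -- boundary data of the four pieces
  let bW := RegularSublevel.boundaryData SphereFourSplitting.isRegularLevel_tubeS
  let bB := RegularSublevel.boundaryData hg
  let bK := RegularSublevel.boundaryData hg.const_sub
  let bV := RegularSublevel.boundaryData SphereFourSplitting.hPolar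
  -- `X = B ∪ K`, with `B` replaced by `W₀` along `Ξ` and `K` by `V₀` along `Φ`
  have hsplit := RegularSublevel.isBoundaryGluing_split hg
  let φ₁ : bW.carrier ≃ₘ⟮𝓡 3, 𝓡 3⟯ bK.carrier :=
    (bW.restrictDiffeomorph bB Ξ).trans (RegularSublevel.splitDiffeomorph hg)
  have h1 : IsBoundaryGluing bW bK φ₁ (𝓡 4) X := hsplit.transfer (b₁ := bW) Ξ
  let φ₂ : bV.carrier ≃ₘ⟮𝓡 3, 𝓡 3⟯ bW.carrier :=
    (bV.restrictDiffeomorph bK Φ.symm).trans φ₁.symm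
  have h2 : IsBoundaryGluing bV bW φ₂ (𝓡 4) X := h1.symm'.transfer (b₁ := bV) Φ.symm
  have h3 : IsBoundaryGluing bW bV φ₂.symm (𝓡 4) X := h2.symm'
  -- the composite gluing map preserves the slices
  have hslice : ∀ z : bW.carrier,
      SphereFourSplitting.ι (SphereFourSplitting.ιV (φ₂.symm z).1) 3 =
          SphereFourSplitting.ι (RegularSublevel.incl SphereFourSplitting.isRegularLevel_tubeS z.1) 3 ∧
        SphereFourSplitting.ι (SphereFourSplitting.ιV (φ₂.symm z).1) 4 =
          SphereFourSplitting.ι (RegularSublevel.incl SphereFourSplitting.isRegularLevel_tubeS z.1) 4 := by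
    intro z
    -- the point `k = φ₁ z ∈ ∂K` and its preimage under `ιX`
    have e2 : bB.incl (bW.restrictDiffeomorph bB Ξ z) = Ξ (bW.incl z) :=
      BoundaryData.incl_restrictDiffeomorph Ξ z
    have hφ₁z : φ₁ z = RegularSublevel.splitDiffeomorph hg (bW.restrictDiffeomorph bB Ξ z) := rfl
    have hkX : RegularSublevel.incl hg.const_sub (φ₁ z).1 =
        ιX (SphereFourSplitting.invParam z.1) := by
      have e1 := RegularSublevel.incl_splitDiffeomorph hg (bW.restrictDiffeomorph bB Ξ z)
      have e3 : RegularSublevel.incl hg (Ξ (bW.incl z)) = ιX (SphereFourSplitting.invParam z.1) :=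
        SphereSideTube.incl_tubeDiffeomorph hemb hrange hιf hg z.1
      rw [hφ₁z, e1, ← e3, ← e2]
      rfl
    -- `φ₂.symm z` lies over `Φ k`
    have e4 : bV.restrictDiffeomorph bK Φ.symm (φ₂.symm z) = φ₁ z := by
      have e3 : φ₁.symm (bV.restrictDiffeomorph bK Φ.symm (φ₂.symm z)) = z :=
        φ₂.apply_symm_apply z
      exact φ₁.symm.injective (e3.trans (φ₁.symm_apply_apply z).symm)
    have e5 : bK.incl (bV.restrictDiffeomorph bK Φ.symm (φ₂.symm z)) =
        Φ.symm (bV.incl (φ₂.symm z)) :=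
      BoundaryData.incl_restrictDiffeomorph Φ.symm _
    rw [e4] at e5
    have hz2 : (φ₂.symm z).1 = Φ (φ₁ z).1 := by
      have : Φ (bK.incl (φ₁ z)) = bV.incl (φ₂.symm z) := by
        rw [e5, Diffeomorph.apply_symm_apply]
      exact this.symm
    obtain ⟨h3', h4'⟩ := hΦ (φ₁ z) (SphereFourSplitting.invParam z.1) hkX
    -- on the boundary `u = 1/2`, so `√2 · r = 1` and `w(x) = (x₃, x₄)`
    have hu : SphereFourSplitting.tubeS (SphereFourSplitting.ιW z.1) = 1 / 2 :=
      (RegularSublevel.mem_boundary_iff SphereFourSplitting.isRegularLevel_tubeS z.1).1 z.2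
    have hrad : √2 * SphereFourSplitting.rad z.1 = 1 := by
      have hr2 : SphereFourSplitting.rad z.1 ^ 2 = 1 / 2 := by
        rw [SphereFourSplitting.rad_sq, hu]; norm_num
      have hrpos := SphereFourSplitting.rad_pos z.1
      have h22 : (√2 : ℝ) ^ 2 = 2 := Real.sq_sqrt zero_le_two
      nlinarith [sq_nonneg (√2 * SphereFourSplitting.rad z.1 - 1), Real.sqrt_nonneg 2,
        mul_pos (Real.sqrt_pos.2 (zero_lt_two' ℝ)) hrpos]
    rw [hz2, h3', h4']
    refine ⟨?_, ?_⟩ <;>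
      simp [SphereFourSplitting.invParam, SphereFourSplitting.invTail_apply_zero,
        SphereFourSplitting.invTail_apply_one, hrad]
  exact stub_sliceRecognition φ₂.symm hslice X h3

/-! ### Variant endgame (the Morse reading of card `one-morse-function-forced-cancellations`)

The six-point Morse function (Stubs 2–4) and two Milnor cancellations give `B` modulo Cerf's
`Γ₄ = 0`; the two-cancellation statement is kept here as the HYPOTHESIS `hTwoCrit` (it was the
registered apex `stub_twoCrit` of the first skeleton; the lead's analysis shows it needs the same
Earle–Eells input as Stub 7 and additionally Cerf, so the main composition above supersedes it;
Stubs 2–4 remain registered bricks). -/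

theorem noLefschetz_of_morseEndgame
    (hTwoCrit :
      (∀ (X : Type) [TopologicalSpace X] [T2Space X] [SecondCountableTopology X] [CompactSpace X]
        [ChartedSpace (𝔼 4) X] [IsManifold (𝓡 4) ∞ X]
        (o : SmoothOrientation (𝓡 4) X) (f : X → 𝕊²),
        IsSimplifiedBrokenLefschetzFibration o f ∅ 0 →
        f '' ({p : X | ¬ Surjective (mfderiv (𝓡 4) (𝓡 2) f p)} \ (↑(∅ : Finset X) : Set X)) =
          sphereEquator 1 →
        ∀ q : X, ¬ Surjective (mfderiv (𝓡 4) (𝓡 2) f q) →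
          mfderiv (𝓡 4) 𝓘(ℝ, ℝ)
            ((fun y : 𝕊² => -(((f q : 𝕊²) : 𝔼 3) 1) * (y : 𝔼 3) 0 +
                (((f q : 𝕊²) : 𝔼 3) 0) * (y : 𝔼 3) 1) ∘ f) q ≠ 0) →
      -- Stub 7 (Earle–Eells-lite) as an input
      gramain_loopHomotopy_translationLoop_torus →
      ∀ (X : Type) [TopologicalSpace X] [T2Space X] [SecondCountableTopology X] [CompactSpace X]
        [ChartedSpace (𝔼 4) X] [IsManifold (𝓡 4) ∞ X] [SimplyConnectedSpace X]
        (o : SmoothOrientation (𝓡 4) X) (f : X → 𝕊²),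
        IsSimplifiedBrokenLefschetzFibration o f ∅ 0 →
        f '' ({p : X | ¬ Surjective (mfderiv (𝓡 4) (𝓡 2) f p)} \ (↑(∅ : Finset X) : Set X)) =
          sphereEquator 1 →
        ∀ (v : 𝕊²), (v : 𝔼 3) 0 = 0 → (v : 𝔼 3) 1 = 0 →
        (∀ y : 𝕊², ⟪(y : 𝔼 3), (v : 𝔼 3)⟫ < 0 →
          (∀ q, f q = y → Surjective (mfderiv (𝓡 4) (𝓡 2) f q)) ∧
          Nonempty ((Fin (2 * 0) → ℤ) ≃ₗ[ℤ] singularHomology ℤ ℤ ↥(f ⁻¹' {y}) 1)) →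
        (∀ y : 𝕊², ⟪(y : 𝔼 3), ((-v : 𝕊²) : 𝔼 3)⟫ < 0 →
          (∀ q, f q = y → Surjective (mfderiv (𝓡 4) (𝓡 2) f q)) ∧
          Nonempty ((Fin (2 * (0 + 1)) → ℤ) ≃ₗ[ℤ] singularHomology ℤ ℤ ↥(f ⁻¹' {y}) 1)) →
        ∀ ℓ : 𝕊² → ℝ, ℓ = (fun y : 𝕊² => (y : 𝔼 3) 0 * (1 + (-(1 / 4 : ℝ)) * ⟪(y : 𝔼 3), (v : 𝔼 3)⟫)) →
        ∀ (ι : 𝕊² × 𝔼 2 → X),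
        Manifold.IsSmoothEmbedding ((𝓡 2).prod (𝓡 2)) (𝓡 4) ∞ ι →
        range ι = f ⁻¹' {y : 𝕊² | ⟪(y : 𝔼 3), (v : 𝔼 3)⟫ < 0} →
        (∀ p, f (ι p) = (stereographic' 2 v).symm
          (OpenPartialHomeomorph.univBall (0 : 𝔼 2) 2 p.2)) →
        ∀ (m M : 𝕊²), m ≠ M → (∀ y : 𝕊², IsMCriticalPt (𝓡 2) ℓ y ↔ (y = m ∨ y = M)) →
        (mhessian (𝓡 2) ℓ m).Nondegenerate → (mhessian (𝓡 2) ℓ M).Nondegenerate →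
        morseIndex (𝓡 2) ℓ m = 0 → morseIndex (𝓡 2) ℓ M = 2 →
        ⟪(m : 𝔼 3), (v : 𝔼 3)⟫ < 0 → ⟪(M : 𝔼 3), (v : 𝔼 3)⟫ < 0 → ℓ m < -1 → 1 < ℓ M →
        ∀ (μ : 𝕊² → ℝ) (xm xM : 𝕊²) (wm wM : 𝔼 2) (r ε : ℝ) (ρ : 𝔼 2 → ℝ) (G : X → ℝ)
          (qm qM : X),
          ContMDiff (𝓡 2) 𝓘(ℝ, ℝ) ∞ μ → xm ≠ xM →
          (∀ x : 𝕊², IsMCriticalPt (𝓡 2) μ x ↔ (x = xm ∨ x = xM)) →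
          (mhessian (𝓡 2) μ xm).Nondegenerate → (mhessian (𝓡 2) μ xM).Nondegenerate →
          morseIndex (𝓡 2) μ xm = 0 → morseIndex (𝓡 2) μ xM = 2 → μ xm < μ xM →
          (stereographic' 2 v).symm (OpenPartialHomeomorph.univBall (0 : 𝔼 2) 2 wm) = m →
          (stereographic' 2 v).symm (OpenPartialHomeomorph.univBall (0 : 𝔼 2) 2 wM) = M → 0 < r →
          2 * r < dist wm wM → 0 < ε → ContDiff ℝ ∞ ρ →
          (∀ w, dist w wm ≤ r / 2 ∨ dist w wM ≤ r / 2 → ρ w = 1) →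
          (∀ w, r ≤ dist w wm → r ≤ dist w wM → ρ w = 0) → ContMDiff (𝓡 4) 𝓘(ℝ, ℝ) ∞ G →
          (∀ x : X, x ∉ range ι → G x = ℓ (f x)) →
          (∀ p : 𝕊² × 𝔼 2, G (ι p) = ℓ (f (ι p)) + ε * ρ p.2 * μ p.1) →
          ¬ Surjective (mfderiv (𝓡 4) (𝓡 2) f qm) → ¬ Surjective (mfderiv (𝓡 4) (𝓡 2) f qM) →
          ((f qm : 𝕊²) : 𝔼 3) 0 = -1 → ((f qM : 𝕊²) : 𝔼 3) 0 = 1 → IsMorse (𝓡 4) G →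
          criticalSet (𝓡 4) G = {ι (xm, wm), ι (xM, wm), qm, qM, ι (xm, wM), ι (xM, wM)} →
          morseIndex (𝓡 4) G (ι (xm, wm)) = 0 → morseIndex (𝓡 4) G (ι (xM, wm)) = 2 →
          morseIndex (𝓡 4) G qm = 1 → morseIndex (𝓡 4) G qM = 3 →
          morseIndex (𝓡 4) G (ι (xm, wM)) = 2 → morseIndex (𝓡 4) G (ι (xM, wM)) = 4 →
          G (ι (xm, wm)) < G (ι (xM, wm)) → G (ι (xM, wm)) < -1 → G qm = -1 → G qM = 1 →
          1 < G (ι (xm, wM)) → G (ι (xm, wM)) < G (ι (xM, wM)) →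
          ∃ G' : X → ℝ, IsMorse (𝓡 4) G' ∧ (criticalSet (𝓡 4) G').ncard = 2)
    (hCerf : cerf_twistedSphere_four) :
    nonempty_diffeomorph_sphere_four_of_sblf_genus_one_noLefschetz := by
  intro X _ _ _ _ _ _ _ hX
  obtain ⟨o, f₀, hf₀⟩ := hX
  -- round image = equator
  obtain ⟨f, hf, hC⟩ := hf₀.exists_image_round_eq_sphereEquator
  -- the pole of the torus side
  obtain ⟨v, hv0, hv1, hlo, hhi⟩ := hf.exists_pole_lower_higher_sides hC
  -- the product structure of the sphere side (proof of
  -- `exists_pole_isSmoothEmbedding_sphere_two_prod_side`, for THIS `v`)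
  obtain ⟨hregv, hNv⟩ := hlo (-v) (inner_neg_self_lt_zero v)
  obtain ⟨s, hs, hsr⟩ := hf.exists_isSmoothEmbedding_sphere_two_fibre_of_linearEquiv_fin_zero
    hregv hNv
  have hreg : ∀ q, ⟪(f q : 𝔼 3), (v : 𝔼 3)⟫ < 0 → Surjective (mfderiv (𝓡 4) (𝓡 2) f q) :=
    fun q hq ↦ (hlo (f q) hq).1 q rfl
  have hdim : Module.finrank ℝ (𝔼 2 × 𝔼 2) = Module.finrank ℝ (𝔼 4) := by
    rw [Module.finrank_prod, finrank_euclideanSpace_fin, finrank_euclideanSpace_fin]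
  let Lq : (𝔼 2 × 𝔼 2) ≃L[ℝ] 𝔼 4 := ContinuousLinearEquiv.ofFinrankEq hdim
  obtain ⟨ι, hemb, hrange, -, hιf⟩ :=
    Literature.Topology.FourManifolds.exists_isSmoothEmbedding_prod_range_eq_preimage_hemisphere
      (I := 𝓡 4) (IF := 𝓡 2) hf.contMDiff v hreg hs Lq hsr
  -- the base function and the round critical points
  obtain ⟨-, m, M, hmM, hcrit, hndm, hndM, him, hiM, hmv, hMv, -, -, -, -, hmval, hMval, -⟩ :=
    stub_baseFunction v hv0 hv1 _ rfl
  have hround := stub_roundCriticalPoints X o f hf hC v hv0 hv1 hlo hhi _ rfl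
  -- the six-point function
  obtain ⟨μ, xm, xM, wm, wM, r, ε, ρ, G, qm, qM, hμ, hx, hμcrit, hndxm, hndxM, hixm, hixM, hμlt,
    hwm, hwM, hr, hrr, hε, hρ, hρ1, hρ0, hG, hGout, hGin, hqm, hqM, hfqm, hfqM, hGM, hcritG,
    hi0, hi2, hi1, hi3, hi2', hi4, hv1', hv2', hv3', hv4', hv5', hv6'⟩ :=
    stub_sixCrit X o f hf hC v hv0 hv1 hlo hhi _ rfl ι hemb hrange hιf m M hmM hcrit hndm hndM him hiM
      hmv hMv hmval hMval hround
  -- two cancellations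
  obtain ⟨G', hG', h2⟩ := hTwoCrit stub_angularSubmersion stub_torusLoops X o f hf hC v hv0 hv1 hlo hhi _ rfl
    ι hemb hrange hιf m M hmM hcrit hndm hndM him hiM hmv hMv hmval hMval μ xm xM wm wM r ε ρ G qm qM hμ hx hμcrit hndxm hndxM hixm hixM hμlt hwm hwM hr
    hrr hε hρ hρ1 hρ0 hG hGout hGin hqm hqM hfqm hfqM hGM hcritG hi0 hi2 hi1 hi3 hi2' hi4 hv1'
    hv2' hv3' hv4' hv5' hv6'
  -- twisted sphere, then Cerf
  haveI : Fact (isSmoothEmbedding_sphereInclusion' 3) := ⟨isSmoothEmbedding_sphereInclusion'_holds 3⟩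
  obtain ⟨φ, hφ⟩ := hG'.exists_isTwistedSphere_of_ncard_criticalSet_eq_two (k := 3) (by norm_num) h2
  exact nonempty_diffeomorph_sphere_four_of_isTwistedSphere_of_cerf hCerf hφ

/-- **The crux `RungOne` BY NAME**, from the stubs: `RungOne ⇐ A ∧ B`
(`RungOne_of_eulerCount_of_noLefschetz`, Theorems/SblfDescentRungOne.lean), `A` discharged in
the tree (`card_eq_four_mul_of_sblf_of_homotopyEquiv_sphere_four_holds`), `B` from the stubs
(`noLefschetz_of_stubs`). [cite: Baykur2012, Lemma 7] [cite: BaykurKamada2015, Lemma 11 and Cor. 14] -/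
theorem RungOne_of : Summit.SmoothPoincare4.SmoothPoincare4.Theses.SblfDescent.RungOne :=
  Summit.SmoothPoincare4.SmoothPoincare4.Theorems.RungOne_of_eulerCount_of_noLefschetz
    card_eq_four_mul_of_sblf_of_homotopyEquiv_sphere_four_holds noLefschetz_of_stubs

end Summit.SmoothPoincare4.SmoothPoincare4.Cruxes.RungOne.Sketch

end
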